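import Summits.QuantumFields.YangMills.Theorems.TwistedTraceScaling.Negative.InnerValleyTargetsGuards
import Summits.QuantumFields.YangMills.Theorems.LuscherReductionRunningReductionKTRCalibration
import HarnessLib

/-!
# Guards on the window floor W(L₁) of S-BASE(L₁) — crux disprover, cycle 59
# (route `LuscherReduction`, crux `TwistedTraceScaling` stmt-QuantumFields-20203, skeleton «twolattice» rev 3, stub S-BASE; `--supports`, helper only)

The fixed-lattice assembly `Base.fixedLatticeTraceLaw_of_upper_lower_window` (`…CoarseTailGlue`) closes S-BASE(L₁) from three inputs:
COARSE-UPPER(L₁) (closing by the shell chain of lane A, `…ShellChain` / `…ShellRecordLow`), COARSE-LOWER(L₁), and the **window floor**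
W(L₁):

  `∀ c₁ > 0, ∃ g : ℕ → ℝ, (∀ k, 0 ≤ g k) ∧ (∀ t > 0, Summable (k ↦ e^{−t·g k})) ∧ ∃ β0, ∀ β ≥ β0, ∀ k,`
  `λ_k(β,L₁) ≤ exp (−(Λ(β,L₁)/L₁ · min (g k) (c₁ log β))) · λ₀(β,L₁)`.

This file records, kernel-checked and `def`-free, what that text FORCES — the standing disprover's mutation / normalisation pass on the
next open node (no kill: W(L₁) is consistent on paper, see the crux workfile `Cruxes/TwistedTraceScaling/Disproof.lean`, VERDICT 59):
* §1 two abstract trivialities: the pointwise unpacking `e^{−uE}x₀ < x ≤ e^{−u·min(g,cap)}x₀, E ≤ cap ⇒ g < E` and the Chebyshev count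
  `#{k ∈ S : g k < E} ≤ e^{tE} Σ' e^{−t g}`;
* §2 ★ on the actual levels `levelValue su2Rep L β ·` at ONE `β` in the window regime (`0 < β`, `0 < Λ(β,L)`):
  `windowFloor_g_zero` (normalisation: the text forces `g 0 = 0`), `windowFloor_lt_of_level` / ★`windowFloor_count`
  (COUNTING form: `λ_m > e^{−uE}λ₀` with `E ≤ c₁ log β` forces `g k < E` for EVERY `k ≤ m` — the levels are antitone — hence
  `m + 1 ≤ e^{tE}·Σ' e^{−t g}` for every `t > 0`), ★`windowFloor_caps_families` (TRIAL-STATE form, through the family max–min principle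
  R6 `le_levelValue_of_family`: a Gram-nondegenerate physical `(m+1)`-family all of whose combinations have Rayleigh quotient `≥ s > e^{−uE}λ₀`
  has `m + 1 ≤ e^{tE}·Σ' e^{−t g}`), and `windowFloor_g_le_of_lower` (squeeze against a COARSE-LOWER instance: `g k ≤ Δ_k + ε`);
  `windowFloor_text_count` packages §2 against the VERBATIM text (`L1 ↦ L`);
* §3 `forallExponent_shape_carries_no_rate` — the logical guard behind §2: a predicate of the landed `∀ A, ∃ β0, ∀ β ≥ β0` shape
  (`ValleyGainAt`, `InnerShellGainSmallAt`, `InnerNoIntruderOneOrbitAt`, … — gain `≥ A` in units of `λ_b`, eventually) is satisfied by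
  the rate `√(log β)`, which is NOT `≥ c log β` eventually for any `c > 0`; so those texts, AS TYPED, do not deliver the `c₁ log β`-uniform
  gain that W(L₁) encodes for families of `≍ β^κ` Gram-independent trial packets (§2: femto energy `≥ (κ/t) log β − O_t(1)` for every `t`).
  The mechanisms behind the landed texts give powers of `β` (only the `∀ A, ∃ β0` export loses the rate), so the W-prover's work is
  (i) re-export the valley / shell gains with rate `A(β) = c₁ log β` and (ii) a `k`-UNIFORM inner BO comparison up to femto energy `c₁ log β`
  joined to the closed child's `OST.windowFloor_all` at `B = L³β` (as `…BaseOne.window_one` does at `L = 1`) — COARSE-DESIGN §5.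
HONEST FRAMING: structural lemmas about an OPEN hypothesis text (W(L₁)) of a stub (S-BASE) of a child of the CONDITIONAL reduction route
R2b1 (femto rung); nothing here proves or refutes W(L₁), COARSE-LOWER or the crux; not infinite volume, not a mass gap, not Clay.
-/

set_option autoImplicit false

noncomputable section

open MeasureTheory Filter Topology Real
open scoped BigOperators
open Literature.MathematicalPhysics.QuantumFieldTheory hiding SU2
open Literature.MathematicalPhysics.QuantumLattice
open Summit.QuantumFields.YangMills.Theorems.FemtoTransferGap

namespace Summit.QuantumFields.YangMills.Theorems.TwistedTraceScaling.Negative.R72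

/-! ## §1 Abstract trivialities -/

/-- Pointwise unpacking of the window-floor inequality: `e^{−uE}x₀ < x ≤ e^{−u·min(g,cap)}x₀` with `u, x₀ > 0` and `E ≤ cap`
forces `g < E`. [folklore] -/
theorem lt_of_windowShape {u x₀ x g cap E : ℝ} (hu : 0 < u) (hx₀ : 0 < x₀) (hE : E ≤ cap)
    (hup : x ≤ Real.exp (-(u * min g cap)) * x₀) (hlow : Real.exp (-(u * E)) * x₀ < x) : g < E := by
  have h1 : Real.exp (-(u * E)) * x₀ < Real.exp (-(u * min g cap)) * x₀ := lt_of_lt_of_le hlow hup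
  have h2 : Real.exp (-(u * E)) < Real.exp (-(u * min g cap)) := lt_of_mul_lt_mul_right h1 hx₀.le
  rw [Real.exp_lt_exp] at h2
  have h3 : min g cap < E := by nlinarith [min_le_left g cap]
  by_contra hge
  push Not at hge
  have : E ≤ min g cap := le_min hge hE
  linarith

/-- Chebyshev count: if `g k < E` for every `k ∈ S` then `#S ≤ e^{tE} · Σ'_k e^{−t·g k}` (`t > 0`, the series summable). [folklore] -/
theorem card_le_exp_mul_tsum {g : ℕ → ℝ} {t E : ℝ} (ht : 0 < t) (hsum : Summable fun k => Real.exp (-t * g k))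
    (S : Finset ℕ) (hS : ∀ k ∈ S, g k < E) : (S.card : ℝ) ≤ Real.exp (t * E) * ∑' k, Real.exp (-t * g k) := by
  have h1 : ∀ k ∈ S, Real.exp (-(t * E)) ≤ Real.exp (-t * g k) := fun k hk => by
    rw [Real.exp_le_exp]; nlinarith [hS k hk]
  have h2 : (S.card : ℝ) * Real.exp (-(t * E)) ≤ ∑ k ∈ S, Real.exp (-t * g k) := by
    have hc : ∑ _k ∈ S, Real.exp (-(t * E)) = (S.card : ℝ) * Real.exp (-(t * E)) := by
      rw [Finset.sum_const, nsmul_eq_mul]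
    rw [← hc]; exact Finset.sum_le_sum h1
  have h3 : ∑ k ∈ S, Real.exp (-t * g k) ≤ ∑' k, Real.exp (-t * g k) :=
    hsum.sum_le_tsum S fun k _ => (Real.exp_pos _).le
  have h4 : Real.exp (t * E) * Real.exp (-(t * E)) = 1 := by rw [← Real.exp_add]; simp
  calc (S.card : ℝ) = Real.exp (t * E) * ((S.card : ℝ) * Real.exp (-(t * E))) := by
        rw [mul_comm (S.card : ℝ), ← mul_assoc, h4, one_mul]
    _ ≤ Real.exp (t * E) * ∑' k, Real.exp (-t * g k) :=
        mul_le_mul_of_nonneg_left (h2.trans h3) (Real.exp_pos _).le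

/-! ## §2 What the window floor forces on the actual levels, at one `β` -/

section Levels

variable {L : ℕ} [NeZero L]

/-- Normalisation audit: at `k = 0` the window-floor text (with `0 < β`, `0 < Λ(β,L)`, `0 < c₁ log β`) forces `g 0 = 0`. [folklore] -/
theorem windowFloor_g_zero {β c₁ : ℝ} {g : ℕ → ℝ} (hβ : 0 < β) (hΛ : 0 < luscherLambda β L) (hcap : 0 < c₁ * Real.log β)
    (hg0 : 0 ≤ g 0)
    (hW0 : levelValue su2Rep L β 0 ≤ Real.exp (-(luscherLambda β L / L * min (g 0) (c₁ * Real.log β))) * levelValue su2Rep L β 0) :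
    g 0 = 0 := by
  have hl0 : 0 < levelValue su2Rep L β 0 := levelValue_su2Rep_pos hβ 0
  have hL : (0 : ℝ) < L := by exact_mod_cast Nat.pos_of_ne_zero (NeZero.ne L)
  have hu : 0 < luscherLambda β L / L := div_pos hΛ hL
  have h1 : 1 ≤ Real.exp (-(luscherLambda β L / L * min (g 0) (c₁ * Real.log β))) := by
    by_contra h
    push Not at h
    have := mul_lt_mul_of_pos_right h hl0
    rw [one_mul] at this
    linarith
  have h2 : luscherLambda β L / L * min (g 0) (c₁ * Real.log β) ≤ 0 := by
    have := Real.one_le_exp_iff.mp h1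
    linarith
  have h3 : min (g 0) (c₁ * Real.log β) ≤ 0 := by
    by_contra h
    push Not at h
    linarith [mul_pos hu h]
  rcases min_le_iff.mp (h3) with h | h
  · linarith
  · linarith

/-- ★ Pointwise: if `λ_m(β,L) > e^{−(Λ/L)E}λ₀(β,L)` with `E ≤ c₁ log β`, the window floor forces `g k < E` for EVERY `k ≤ m`
(the levels are antitone in `k`). [cite: ReedSimonIV1978, Thm. XIII.1] -/
theorem windowFloor_lt_of_level {β c₁ E : ℝ} {g : ℕ → ℝ} {m : ℕ} (hβ : 0 < β) (hΛ : 0 < luscherLambda β L) (hE : E ≤ c₁ * Real.log β)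
    (hW : ∀ k : ℕ, levelValue su2Rep L β k ≤ Real.exp (-(luscherLambda β L / L * min (g k) (c₁ * Real.log β))) * levelValue su2Rep L β 0)
    (hm : Real.exp (-(luscherLambda β L / L * E)) * levelValue su2Rep L β 0 < levelValue su2Rep L β m) :
    ∀ k, k ≤ m → g k < E := by
  intro k hk
  have hl0 : 0 < levelValue su2Rep L β 0 := levelValue_su2Rep_pos hβ 0
  have hL : (0 : ℝ) < L := by exact_mod_cast Nat.pos_of_ne_zero (NeZero.ne L)
  have hu : 0 < luscherLambda β L / L := div_pos hΛ hL
  have hkm : levelValue su2Rep L β m ≤ levelValue su2Rep L β k := KTRCalibration.levelValue_antitone hβ.le hk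
  exact lt_of_windowShape hu hl0 hE (hW k) (lt_of_lt_of_le hm hkm)

/-- ★ COUNTING form of the window floor: `λ_m > e^{−(Λ/L)E}λ₀`, `E ≤ c₁ log β` forces `m + 1 ≤ e^{tE}·Σ'_k e^{−t·g k}` for every `t > 0` —
the number of lattice levels above `e^{−uE}λ₀` is at most the (sub-exponentially growing) `g`-count below `E`, uniformly for `E ≤ c₁ log β`.
[cite: ReedSimonIV1978, Thm. XIII.1] -/
theorem windowFloor_count {β c₁ E t : ℝ} {g : ℕ → ℝ} {m : ℕ} (hβ : 0 < β) (hΛ : 0 < luscherLambda β L) (hE : E ≤ c₁ * Real.log β)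
    (ht : 0 < t) (hsum : Summable fun k => Real.exp (-t * g k))
    (hW : ∀ k : ℕ, levelValue su2Rep L β k ≤ Real.exp (-(luscherLambda β L / L * min (g k) (c₁ * Real.log β))) * levelValue su2Rep L β 0)
    (hm : Real.exp (-(luscherLambda β L / L * E)) * levelValue su2Rep L β 0 < levelValue su2Rep L β m) :
    (m : ℝ) + 1 ≤ Real.exp (t * E) * ∑' k, Real.exp (-t * g k) := by
  have h := card_le_exp_mul_tsum ht hsum (Finset.range (m + 1)) fun k hk =>
    windowFloor_lt_of_level hβ hΛ hE hW hm k (Nat.lt_succ_iff.mp (Finset.mem_range.mp hk))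
  simpa [Finset.card_range] using h

/-- ★ TRIAL-STATE form of the window floor (through R6 `le_levelValue_of_family`): a physical, Gram-nondegenerate `(m+1)`-family all of whose
combinations `ψ` satisfy `s‖ψ‖² ≤ ⟨ψ,K_βψ⟩` with `s > e^{−(Λ/L)E}λ₀(β,L)`, `E ≤ c₁ log β`, has `m + 1 ≤ e^{tE}·Σ'_k e^{−t·g k}` (`t > 0`).
Read contrapositively: `≍ β^κ` Gram-independent physical trial packets (e.g. disjointly supported valley / shell packets) cannot ALL have femto
energy below `(κ/t)·log β − log(Σ' e^{−tg})/t` — the valley / shell GAIN along such families must be super-logarithmic in `β`.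
[cite: ReedSimonIV1978, Thm. XIII.1] -/
theorem windowFloor_caps_families {β c₁ E t s : ℝ} {g : ℕ → ℝ} {m : ℕ} (hβ : 0 < β) (hΛ : 0 < luscherLambda β L)
    (hE : E ≤ c₁ * Real.log β) (ht : 0 < t) (hsum : Summable fun k => Real.exp (-t * g k))
    (hW : ∀ k : ℕ, levelValue su2Rep L β k ≤ Real.exp (-(luscherLambda β L / L * min (g k) (c₁ * Real.log β))) * levelValue su2Rep L β 0)
    (F : Fin (m + 1) → GaugeConfig 3 L SU2 → ℝ) (hF : ∀ i, IsPhys (F i))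
    (hGram : ∀ a : Fin (m + 1) → ℝ, a ≠ 0 → 0 < l2 (fun U => ∑ i, a i * F i U) (fun U => ∑ i, a i * F i U))
    (hs : ∀ a : Fin (m + 1) → ℝ, s * l2 (fun U => ∑ i, a i * F i U) (fun U => ∑ i, a i * F i U) ≤
      qform su2Rep β (fun U => ∑ i, a i * F i U) (fun U => ∑ i, a i * F i U))
    (hsE : Real.exp (-(luscherLambda β L / L * E)) * levelValue su2Rep L β 0 < s) :
    (m : ℝ) + 1 ≤ Real.exp (t * E) * ∑' k, Real.exp (-t * g k) :=
  windowFloor_count hβ hΛ hE ht hsum hW (lt_of_lt_of_le hsE (R6.le_levelValue_of_family β F hF hGram hs))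

/-- Squeeze against a COARSE-LOWER instance: `e^{−(Δ+ε)u}λ₀ ≤ λ_k ≤ e^{−u·min(g k, c₁ log β)}λ₀` with `Δ + ε < c₁ log β` forces
`g k ≤ Δ + ε` — any admissible `g` lies below the one-site gaps (so `Σ e^{−t g}` converging is at least as strong as the gap summability LGS).
[folklore] -/
theorem windowFloor_g_le_of_lower {β c₁ D : ℝ} {g : ℕ → ℝ} {k : ℕ} (hβ : 0 < β) (hΛ : 0 < luscherLambda β L) (hD : D < c₁ * Real.log β)
    (hWk : levelValue su2Rep L β k ≤ Real.exp (-(luscherLambda β L / L * min (g k) (c₁ * Real.log β))) * levelValue su2Rep L β 0)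
    (hLk : Real.exp (-(D * luscherLambda β L) / L) * levelValue su2Rep L β 0 ≤ levelValue su2Rep L β k) : g k ≤ D := by
  have hl0 : 0 < levelValue su2Rep L β 0 := levelValue_su2Rep_pos hβ 0
  have hL : (0 : ℝ) < L := by exact_mod_cast Nat.pos_of_ne_zero (NeZero.ne L)
  have hu : 0 < luscherLambda β L / L := div_pos hΛ hL
  have h1 : Real.exp (-(D * luscherLambda β L) / L) ≤ Real.exp (-(luscherLambda β L / L * min (g k) (c₁ * Real.log β))) :=
    le_of_mul_le_mul_right (hLk.trans hWk) hl0
  rw [Real.exp_le_exp] at h1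
  have h2 : luscherLambda β L / L * min (g k) (c₁ * Real.log β) ≤ luscherLambda β L / L * D := by
    have : -(D * luscherLambda β L) / L = -(luscherLambda β L / L * D) := by ring
    linarith [this]
  have h3 : min (g k) (c₁ * Real.log β) ≤ D := le_of_mul_le_mul_left h2 hu
  rcases min_le_iff.mp h3 with h | h
  · exact h
  · linarith

/-- The window-floor TEXT of `Base.fixedLatticeTraceLaw_of_upper_lower_window` (hypothesis `hW`, verbatim with `L1 ↦ L`), unpacked into its
COUNTING content: for every cap `c₁ > 0` there are `g ≥ 0` with `Σ e^{−tg} < ∞` (all `t > 0`) and `β0` such that for `β ≥ β0` in the regime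
`0 < β`, `0 < Λ(β,L)` (automatic for large `β`, `…BaseWindow.exists_window_of_large_beta`), every `E ≤ c₁ log β` and every level `m` with
`λ_m > e^{−(Λ/L)E}λ₀` satisfy `m + 1 ≤ e^{tE}·Σ' e^{−tg}` for all `t > 0`. [cite: ReedSimonIV1978, Thm. XIII.1] -/
theorem windowFloor_text_count
    (hWtext : ∀ c₁ : ℝ, 0 < c₁ → ∃ g : ℕ → ℝ, (∀ k, 0 ≤ g k) ∧
      (∀ t : ℝ, 0 < t → Summable fun k : ℕ => Real.exp (-t * g k)) ∧
      ∃ β0 : ℝ, ∀ β : ℝ, β0 ≤ β → ∀ k : ℕ,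
        levelValue su2Rep L β k ≤
          Real.exp (-(luscherLambda β L / L * min (g k) (c₁ * Real.log β))) * levelValue su2Rep L β 0)
    (c₁ : ℝ) (hc₁ : 0 < c₁) :
    ∃ g : ℕ → ℝ, (∀ k, 0 ≤ g k) ∧ (∀ t : ℝ, 0 < t → Summable fun k : ℕ => Real.exp (-t * g k)) ∧
      ∃ β0 : ℝ, ∀ β : ℝ, β0 ≤ β → 0 < β → 0 < luscherLambda β L → ∀ E : ℝ, E ≤ c₁ * Real.log β → ∀ m : ℕ,
        Real.exp (-(luscherLambda β L / L * E)) * levelValue su2Rep L β 0 < levelValue su2Rep L β m →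
          ∀ t : ℝ, 0 < t → (m : ℝ) + 1 ≤ Real.exp (t * E) * ∑' k, Real.exp (-t * g k) := by
  obtain ⟨g, hg0, hgsum, β0, hW⟩ := hWtext c₁ hc₁
  exact ⟨g, hg0, hgsum, β0, fun β hβ hβpos hΛ E hE m hm t ht => windowFloor_count hβpos hΛ hE ht (hgsum t ht) (hW β hβ) hm⟩

end Levels

/-! ## §3 The `∀ A, ∃ β0` shape carries no rate -/

/-- The logical guard behind §2: the shape `∀ A, ∃ β0, ∀ β ≥ β0, A ≤ f β` of the landed gain / no-intruder texts is met by `f β = √(log β)`,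
which is NOT eventually `≥ c·log β` for any `c > 0`.  (So those texts, as typed, are implied by but do not imply a `c₁ log β`-uniform gain.)
[folklore] -/
theorem forallExponent_shape_carries_no_rate :
    ∃ f : ℝ → ℝ, (∀ A : ℝ, ∃ β0 : ℝ, ∀ β : ℝ, β0 ≤ β → A ≤ f β) ∧
      ∀ c : ℝ, 0 < c → ∀ β0 : ℝ, ∃ β : ℝ, β0 ≤ β ∧ f β < c * Real.log β := by
  refine ⟨fun β => Real.sqrt (Real.log β), fun A => ⟨Real.exp (A ^ 2), fun β hβ => ?_⟩, fun c hc β0 => ?_⟩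
  · have hβpos : 0 < β := lt_of_lt_of_le (Real.exp_pos _) hβ
    have hlog : A ^ 2 ≤ Real.log β := by
      have := Real.log_le_log (Real.exp_pos _) hβ
      rwa [Real.log_exp] at this
    calc A ≤ |A| := le_abs_self A
      _ = Real.sqrt (A ^ 2) := (Real.sqrt_sq_eq_abs A).symm
      _ ≤ Real.sqrt (Real.log β) := Real.sqrt_le_sqrt hlog
  · refine ⟨max β0 (Real.exp (1 / c ^ 2 + 1)), le_max_left _ _, ?_⟩
    set β := max β0 (Real.exp (1 / c ^ 2 + 1)) with hβdef
    have hβpos : 0 < β := lt_of_lt_of_le (Real.exp_pos _) (le_max_right _ _)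
    have hlog : 1 / c ^ 2 + 1 ≤ Real.log β := by
      have := Real.log_le_log (Real.exp_pos _) (le_max_right β0 (Real.exp (1 / c ^ 2 + 1)))
      rwa [Real.log_exp] at this
    have hc2 : 0 < c ^ 2 := by positivity
    have hy1 : 1 / c ^ 2 < Real.log β := by linarith
    have hypos : 0 < Real.log β := lt_trans (by positivity) hy1
    -- `√y < c y ↔ 1 < c √y ↔ 1/c² < y`
    have hsq : 0 < Real.sqrt (Real.log β) := Real.sqrt_pos.mpr hypos
    have hkey : 1 < c * Real.sqrt (Real.log β) := by
      have h3 : 1 / c < Real.sqrt (Real.log β) := by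
        refine (Real.lt_sqrt (div_pos one_pos hc).le).mpr ?_
        rw [div_pow, one_pow]; exact hy1
      calc (1 : ℝ) = c * (1 / c) := by field_simp
        _ < c * Real.sqrt (Real.log β) := mul_lt_mul_of_pos_left h3 hc
    calc Real.sqrt (Real.log β) = Real.sqrt (Real.log β) * 1 := (mul_one _).symm
      _ < Real.sqrt (Real.log β) * (c * Real.sqrt (Real.log β)) := mul_lt_mul_of_pos_left hkey hsq
      _ = c * (Real.sqrt (Real.log β) * Real.sqrt (Real.log β)) := by ring
      _ = c * Real.log β := by rw [Real.mul_self_sqrt hypos.le]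

end Summit.QuantumFields.YangMills.Theorems.TwistedTraceScaling.Negative.R72

end
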